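import Summits.QuantumFields.YangMills.Theorems.FemtoTransferGapRungW1upLink
import Literature.MathematicalPhysics.QuantumFieldTheory.SU2OneLinkIntegrals

/-!
# The sharp Gaussian upper bound on the one-link normaliser `c(B) = ∫_{SU(2)} e^{B Re tr W} dW`
# (support module for the registered stub `stub_absLower` of crux `OneSiteLevels`, route `LuscherReduction`,
# item stmt-QuantumFields-20007; fleet seat prover ym-luscher-20007-p2)

The absolute quasimode floors of crux ONE are stated against `c(B)³` (`oneLinkFactor B = linkC B`).  The flat Gaussian model
of the three-link kinetic factor has mass `e^{6B}(π/B)^{9/2}(2π²)^{-3}`, so closing the quasimode estimate needs the upper bound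

  `c(B) ≤ e^{2B} · √(π/B)³ / (2π²)`   for every `B > 0`   (`linkC_le_gauss`)

with EXACTLY the Gaussian constant (the tree's `integral_exp_mul_re_trace_le` has `π²√π/16` in place of `√π/(2π)`).  Proof:
Weyl's formula `c(B) = (2/π)∫₀^π e^{2B cos θ} sin²θ dθ` (tree: `SU2OneLink.integral_exp_mul_re_trace_eq`), the half-angle substitution
`w = sin(θ/2)` (`cos θ = 1 − 2w²`, `sin²θ dθ = 8w² cos²(θ/2) · d(θ/2)`, and `cos(θ/2) ≤ 1`), and the Gaussian moment
`∫₀^∞ w² e^{-4Bw²} dw = √π/(4·(4B)^{3/2})` (Mathlib `integral_rpow_mul_exp_neg_mul_rpow`).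

## WHAT THIS IS NOT
One real-variable estimate ([folklore] / [cite: MontvayMunster1994, §3.2.3 (3.97)]); NOT the stub, NOT THE CLAY GAP.  Sorry-free.
-/

set_option autoImplicit false

noncomputable section

open MeasureTheory Filter Topology Real Set
open Literature.MathematicalPhysics.QuantumFieldTheory
open Literature.MathematicalPhysics.QuantumLattice

namespace Summit.QuantumFields.YangMills.Theorems.FemtoTransferGap

/-- The Gaussian second moment on the half-line: `∫₀^∞ w² e^{-a w²} dw = √π / (4 a √a)` (`a > 0`). [folklore] -/
theorem integral_Ioi_sq_mul_exp_neg_mul_sq {a : ℝ} (ha : 0 < a) :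
    ∫ w in Ioi (0:ℝ), w ^ 2 * Real.exp (-a * w ^ 2) = Real.sqrt π / (4 * (a * Real.sqrt a)) := by
  have h := integral_rpow_mul_exp_neg_mul_rpow (p := 2) (q := 2) (by norm_num) (by norm_num) ha
  have e1 : ∫ w in Ioi (0:ℝ), w ^ 2 * Real.exp (-a * w ^ 2) = ∫ w in Ioi (0:ℝ), w ^ (2:ℝ) * Real.exp (-a * w ^ (2:ℝ)) := by
    refine setIntegral_congr_fun measurableSet_Ioi fun w _ => ?_
    simp only [Real.rpow_two]
  rw [e1, h]
  have hG : Real.Gamma ((2 + 1) / 2) = Real.sqrt π / 2 := by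
    rw [show ((2:ℝ) + 1) / 2 = 1 / 2 + 1 by norm_num, Real.Gamma_add_one (by norm_num), Real.Gamma_one_half_eq]
    ring
  rw [hG]
  have ha32 : a ^ (-((2:ℝ) + 1) / 2) = 1 / (a * Real.sqrt a) := by
    rw [show -((2:ℝ) + 1) / 2 = -(1 + 1 / 2) by norm_num, Real.rpow_neg ha.le, Real.rpow_add ha, Real.rpow_one,
      ← Real.sqrt_eq_rpow, one_div]
  rw [ha32]
  field_simp
  ring

/-- The half-angle form of Weyl's integrand, with `cos(θ/2) ≤ 1` used once:
`e^{2B cos θ} sin²θ ≤ 8 e^{2B} · (w² e^{-4Bw²})(θ) · (½ cos(θ/2))`, `w = sin(θ/2)`, for `θ ∈ [0,π]`. [folklore] -/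
theorem weyl_integrand_le (B : ℝ) {θ : ℝ} (hθ : θ ∈ Icc (0:ℝ) π) :
    Real.exp (B * (2 * Real.cos θ)) * Real.sin θ ^ 2 ≤
      8 * Real.exp (2 * B) * ((Real.sin (θ / 2)) ^ 2 * Real.exp (-(4 * B) * Real.sin (θ / 2) ^ 2)) *
        (1 / 2 * Real.cos (θ / 2)) := by
  have hcos : Real.cos θ = 1 - 2 * Real.sin (θ / 2) ^ 2 := by
    rw [Real.sin_sq_eq_half_sub, show 2 * (θ / 2) = θ by ring]; ring
  have hsin : Real.sin θ = 2 * Real.sin (θ / 2) * Real.cos (θ / 2) := by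
    rw [← Real.sin_two_mul, show 2 * (θ / 2) = θ by ring]
  have hc0 : 0 ≤ Real.cos (θ / 2) := Real.cos_nonneg_of_mem_Icc ⟨by linarith [hθ.1, Real.pi_pos], by linarith [hθ.2]⟩
  have hc1 : Real.cos (θ / 2) ≤ 1 := Real.cos_le_one _
  have hexp : Real.exp (B * (2 * Real.cos θ)) = Real.exp (2 * B) * Real.exp (-(4 * B) * Real.sin (θ / 2) ^ 2) := by
    rw [← Real.exp_add, hcos]; ring_nf
  rw [hexp, hsin]
  have hw : 0 ≤ Real.sin (θ / 2) ^ 2 := sq_nonneg _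
  have hE : 0 ≤ Real.exp (2 * B) * Real.exp (-(4 * B) * Real.sin (θ / 2) ^ 2) := by positivity
  -- `cos² ≤ cos` since `0 ≤ cos ≤ 1`
  have hcc : Real.cos (θ / 2) ^ 2 ≤ Real.cos (θ / 2) := by nlinarith
  nlinarith [mul_nonneg (mul_nonneg hE hw) (sub_nonneg.2 hcc)]

/-- **Weyl's integral, Gaussian bound**: `∫₀^π e^{2B cos θ} sin²θ dθ ≤ e^{2B} √π / (4B√B)` (`B > 0`). [folklore] -/
theorem weyl_integral_le {B : ℝ} (hB : 0 < B) :
    ∫ θ in (0:ℝ)..π, Real.exp (B * (2 * Real.cos θ)) * Real.sin θ ^ 2 ≤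
      Real.exp (2 * B) * (Real.sqrt π / (4 * (B * Real.sqrt B))) := by
  have hπ := Real.pi_pos
  set F : ℝ → ℝ := fun w => w ^ 2 * Real.exp (-(4 * B) * w ^ 2) with hF
  have hFc : Continuous F := by rw [hF]; fun_prop
  -- Step 1: pointwise bound and monotonicity of the interval integral
  have h1 : ∫ θ in (0:ℝ)..π, Real.exp (B * (2 * Real.cos θ)) * Real.sin θ ^ 2 ≤
      ∫ θ in (0:ℝ)..π, 8 * Real.exp (2 * B) * ((F ∘ fun θ => Real.sin (θ / 2)) θ * (1 / 2 * Real.cos (θ / 2))) := by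
    refine intervalIntegral.integral_mono_on hπ.le ?_ ?_ fun θ hθ => ?_
    · exact (by fun_prop : Continuous fun θ => Real.exp (B * (2 * Real.cos θ)) * Real.sin θ ^ 2).intervalIntegrable _ _
    · exact (by rw [hF]; fun_prop : Continuous fun θ : ℝ =>
        8 * Real.exp (2 * B) * ((F ∘ fun θ => Real.sin (θ / 2)) θ * (1 / 2 * Real.cos (θ / 2)))).intervalIntegrable _ _
    · have := weyl_integrand_le B hθ
      simpa only [hF, Function.comp, mul_assoc] using this
  -- Step 2: substitution `w = sin(θ/2)`
  have hderiv : ∀ θ ∈ uIcc (0:ℝ) π, HasDerivAt (fun θ => Real.sin (θ / 2)) (1 / 2 * Real.cos (θ / 2)) θ := by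
    intro θ _
    have h := (Real.hasDerivAt_sin (θ / 2)).comp θ ((hasDerivAt_id θ).div_const 2)
    have e : (Real.sin ∘ fun x : ℝ => id x / 2) = fun θ => Real.sin (θ / 2) := rfl
    rw [e] at h
    exact h.congr_deriv (by ring)
  have h2 : ∫ θ in (0:ℝ)..π, (F ∘ fun θ => Real.sin (θ / 2)) θ * (1 / 2 * Real.cos (θ / 2)) = ∫ w in (0:ℝ)..1, F w := by
    rw [intervalIntegral.integral_comp_mul_deriv' hderiv (by fun_prop) hFc.continuousOn]
    simp
  -- Step 3: `∫₀¹ F ≤ ∫₀^∞ F = √π/(4·(4B)√(4B))`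
  have hFnn : ∀ w, 0 ≤ F w := fun w => by rw [hF]; positivity
  have hFint : IntegrableOn F (Ioi 0) := by
    have h := integrableOn_rpow_mul_exp_neg_mul_sq (b := 4 * B) (by positivity) (s := 2) (by norm_num)
    refine (integrableOn_congr_fun (fun w (_ : w ∈ Ioi (0:ℝ)) => ?_) measurableSet_Ioi).1 h
    simp only [hF, Real.rpow_two]
  have h3 : ∫ w in (0:ℝ)..1, F w ≤ Real.sqrt π / (4 * (4 * B * Real.sqrt (4 * B))) := by
    rw [intervalIntegral.integral_of_le zero_le_one, ← integral_Ioi_sq_mul_exp_neg_mul_sq (by positivity : 0 < 4 * B)]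
    exact setIntegral_mono_set hFint (ae_of_all _ hFnn) (ae_of_all _ Ioc_subset_Ioi_self)
  have h4 : Real.sqrt (4 * B) = 2 * Real.sqrt B := by
    rw [Real.sqrt_mul (by norm_num), show Real.sqrt 4 = 2 by rw [show (4:ℝ) = 2 ^ 2 by norm_num, Real.sqrt_sq (by norm_num)]]
  rw [h4] at h3
  calc ∫ θ in (0:ℝ)..π, Real.exp (B * (2 * Real.cos θ)) * Real.sin θ ^ 2
      ≤ ∫ θ in (0:ℝ)..π, 8 * Real.exp (2 * B) * ((F ∘ fun θ => Real.sin (θ / 2)) θ * (1 / 2 * Real.cos (θ / 2))) := h1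
    _ = 8 * Real.exp (2 * B) * ∫ w in (0:ℝ)..1, F w := by rw [intervalIntegral.integral_const_mul, h2]
    _ ≤ 8 * Real.exp (2 * B) * (Real.sqrt π / (4 * (4 * B * (2 * Real.sqrt B)))) :=
        mul_le_mul_of_nonneg_left h3 (by positivity)
    _ = Real.exp (2 * B) * (Real.sqrt π / (4 * (B * Real.sqrt B))) := by
        field_simp
        ring

/-- **`c(B) ≤ e^{2B} √(π/B)³/(2π²)`** — the sharp Gaussian upper bound on the one-link normaliser `linkC B = ∫ e^{B Re tr W} dW`
(`= oneLinkFactor B` of crux ONE), for every `B > 0`. [cite: MontvayMunster1994, §3.2.3 (3.97) p.121] -/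
theorem linkC_le_gauss {B : ℝ} (hB : 0 < B) :
    linkC B ≤ Real.exp (2 * B) * Real.sqrt (π / B) ^ 3 / (2 * π ^ 2) := by
  have hπ := Real.pi_pos
  have hw := weyl_integral_le hB
  have e : linkC B = 2 / π * ∫ θ in (0:ℝ)..π, Real.exp (B * (2 * Real.cos θ)) * Real.sin θ ^ 2 := by
    unfold linkC linkW
    exact SU2OneLink.integral_exp_mul_re_trace_eq B
  rw [e]
  have hsq3 : Real.sqrt (π / B) ^ 3 = π * Real.sqrt π / (B * Real.sqrt B) := by
    have hp : Real.sqrt π ^ 2 = π := Real.sq_sqrt hπ.le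
    have hb : Real.sqrt B ^ 2 = B := Real.sq_sqrt hB.le
    rw [Real.sqrt_div hπ.le, div_pow]
    rw [show Real.sqrt π ^ 3 = Real.sqrt π ^ 2 * Real.sqrt π by ring, show Real.sqrt B ^ 3 = Real.sqrt B ^ 2 * Real.sqrt B by ring,
      hp, hb]
  rw [hsq3]
  calc 2 / π * ∫ θ in (0:ℝ)..π, Real.exp (B * (2 * Real.cos θ)) * Real.sin θ ^ 2
      ≤ 2 / π * (Real.exp (2 * B) * (Real.sqrt π / (4 * (B * Real.sqrt B)))) := mul_le_mul_of_nonneg_left hw (by positivity)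
    _ = Real.exp (2 * B) * (π * Real.sqrt π / (B * Real.sqrt B)) / (2 * π ^ 2) := by
        field_simp
        ring

/-- The cube: `c(B)³ ≤ e^{6B} √(π/B)⁹ / (2π²)³`. [folklore] -/
theorem linkC_pow_three_le_gauss {B : ℝ} (hB : 0 < B) :
    linkC B ^ 3 ≤ Real.exp (6 * B) * Real.sqrt (π / B) ^ 9 / (2 * π ^ 2) ^ 3 := by
  have h := linkC_le_gauss hB
  have h0 : 0 ≤ linkC B := (linkC_pos hB.le).le
  calc linkC B ^ 3 ≤ (Real.exp (2 * B) * Real.sqrt (π / B) ^ 3 / (2 * π ^ 2)) ^ 3 := pow_le_pow_left₀ h0 h 3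
    _ = Real.exp (6 * B) * Real.sqrt (π / B) ^ 9 / (2 * π ^ 2) ^ 3 := by
        rw [div_pow, mul_pow, ← Real.exp_nat_mul, ← pow_mul]
        norm_num
        left; ring

end Summit.QuantumFields.YangMills.Theorems.FemtoTransferGap

end
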